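import Mathlib
import Summits.AtomisticToContinuum.FouriersLaw.Theses.EmbeddedDrudeMourre
import Literature.MathematicalPhysics.KineticTheory.ZeroWavenumberSpace
import Literature.MathematicalPhysics.KineticTheory.InfiniteChainSuperstableDynamics
import Summits.AtomisticToContinuum.FouriersLaw.Theorems.EmbeddedDrudeMourreMourreDissolutionSymmetricFramework
import Summits.AtomisticToContinuum.FouriersLaw.Theorems.EmbeddedDrudeMourreMourreDissolutionSpectralWindow
import Summits.AtomisticToContinuum.FouriersLaw.Theorems.EmbeddedDrudeMourreMourreDissolutionPairThresholdB
import Summits.AtomisticToContinuum.FouriersLaw.Theorems.EmbeddedDrudeMourreMourreDissolutionOddParityFloor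
import Summits.AtomisticToContinuum.FouriersLaw.Theorems.EmbeddedDrudeMourreMourreDissolutionOddTowerFloor
import Summits.AtomisticToContinuum.FouriersLaw.Theorems.EmbeddedDrudeMourreMourreDissolutionFreeLevelShift
import HarnessLib

/-!
# `MourreDissolution` from the odd threshold LAP — the reduction of line `swap-odd-threshold-rigidity` in the tree
(crux `EmbeddedDrudeMourre.MourreDissolution`, item stmt-AtomisticToContinuum-12594; reduction file, `--supports`)

The checked skeleton of line `swap-odd-threshold-rigidity` (Cruxes workfile, lead c9 v17) is complete modulo its
engine stub D `stub_oddThresholdLAP`. This file makes the same composition IMPORTABLE: the crux follows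
* from the conclusion of D alone (`mourreDissolution_of_oddThresholdLAP`: for `T < T₀` feed the symmetric
  zero-wavenumber framework E (`stub_zeroWavenumberFramework`, tree) to the LAP, and turn the locally uniform
  Abelian LAP of `C_T` — continuous (strong continuity), even (`currentCorrelation_neg`) and positive-definite
  (`sum_mul_currentCorrelation_nonneg`) — into the window density by F (`stub_spectralWindow`, tree)), and
* from D with its REGISTERED signature `A → B → towerFloor → (conclusion)` (`mourreDissolution_of_stub_oddThresholdLAP`),
  its three hypotheses being theorems of the tree: A `stub_pairThreshold`, B `freeLevelShift_threshold` (lead c9),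
  towerFloor `stub_oddTowerFloor stub_oddParityFloor`.
No new mathematics; D itself (limiting absorption at frequency `0` for the current in the odd sector of every
admissible datum, with `g(0) > 0`) is the open heart of the crux and is NOT claimed.
-/

noncomputable section

namespace Summit.AtomisticToContinuum.FouriersLaw.Theorems.MourreDissolution

open MeasureTheory Filter Set Function Topology
open scoped InnerProductSpace ENNReal
open Literature.MathematicalPhysics.KineticTheory
open Literature.MathematicalPhysics.KineticTheory.HeatConduction
open Literature.MathematicalPhysics.KineticTheory.PhononBoltzmann

/-- **The crux from the odd threshold LAP.** If for `pinnedChain ω₂ lam β γ` with an odd-sector gap there is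
`T₀ > 0` such that for every `T ∈ (0, T₀)` and every admissible symmetric zero-wavenumber datum the Abel/Poisson
transforms of the current autocorrelation converge locally uniformly on a window around frequency `0` to `πg`
with `g` continuous and `g(0) > 0` (the conclusion of stub D of line `swap-odd-threshold-rigidity`), then
`MourreDissolution` holds. [folklore] -/
theorem mourreDissolution_of_oddThresholdLAP :
    (∀ ω₂ lam β γ : ℝ, 0 < ω₂ → 0 < lam → 0 < β → 0 < γ → HasOddSectorGap ω₂ lam β →
       ∃ T₀ : ℝ, 0 < T₀ ∧ ∀ T : ℝ, 0 < T → T < T₀ →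
         ∀ (D : InfiniteChainDynamics (pinnedChain ω₂ lam β γ))
           (Z : ZeroWavenumberData (pinnedChain ω₂ lam β γ) D),
           (pinnedChain ω₂ lam β γ).IsChainGibbsMeasure T Z.μ →
           (pinnedChain ω₂ lam β γ).HasSuperstabilityEstimate Z.μ →
           Z.HasMomentumReversal →
           Z.toFluctuationDynamics.IsStronglyContinuous →
           MeasurePreserving (fun (σ : ChainConfig) (i : ℤ) => σ (-i)) Z.μ Z.μ →
           Set.MapsTo (fun (σ : ChainConfig) (i : ℤ) => σ (-i)) D.carrier D.carrier →
           (∀ a ∈ Z.localObs, (a ∘ fun (σ : ChainConfig) (i : ℤ) => σ (-i)) ∈ Z.localObs) →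
           (∀ t : ℝ, (fun (σ : ChainConfig) (i : ℤ) => σ (-i)) ∘ D.flow t =ᵐ[Z.μ]
             D.flow t ∘ fun (σ : ChainConfig) (i : ℤ) => σ (-i)) →
           ∃ δ : ℝ, 0 < δ ∧ ∃ g : ℝ → ℝ, ContinuousOn g (Set.Ioo (-δ) δ) ∧ 0 < g 0 ∧
             TendstoLocallyUniformlyOn
               (fun (ν : ℝ) (ω : ℝ) => ∫ t in Set.Ioi (0 : ℝ),
                 Real.exp (-(ν * t)) * (Real.cos (ω * t) * D.currentCorrelation Z.μ t))
               (fun ω => Real.pi * g ω) (𝓝[>] (0 : ℝ)) (Set.Ioo (-δ) δ)) →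
    Summit.AtomisticToContinuum.FouriersLaw.Theses.EmbeddedDrudeMourre.MourreDissolution := by
  intro hLAP ω₂ lam β γ hω hl hβ hγ hgap
  obtain ⟨T₀, hT₀, hcore⟩ := hLAP ω₂ lam β γ hω hl hβ hγ hgap
  refine ⟨T₀, hT₀, fun T hT hTlt => ?_⟩
  obtain ⟨D, Z, hG, hSS, hR, hsc, hι, hιc, hιo, hιflow⟩ :=
    stub_zeroWavenumberFramework ω₂ lam β γ hω hl hβ hγ T hT
  obtain ⟨δ, hδ, g, hg, hg0, hconv⟩ := hcore T hT hTlt D Z hG hSS hR hsc hι hιc hιo hιflow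
  -- the current autocorrelation is continuous, even and positive-definite (tree, Bochner inputs)
  have hmean := Z.integral_bondCurrent_eq_zero hR
  have hkoop : Continuous fun t : ℝ => Z.koopman t Z.currentClass := hsc Z.currentClass
  have hinner : Continuous fun t : ℝ => ⟪Z.currentClass, Z.koopman t Z.currentClass⟫_ℝ :=
    continuous_const.inner hkoop
  have hCcont : Continuous (D.currentCorrelation Z.μ) := by
    have h := hinner
    simp_rw [Z.inner_currentClass_koopman_eq_currentCorrelation' hR] at h
    exact h
  have heven : ∀ t : ℝ, D.currentCorrelation Z.μ (-t) = D.currentCorrelation Z.μ t :=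
    fun t => Z.currentCorrelation_neg hR t
  have hpd : ∀ (n : ℕ) (c τ : Fin n → ℝ),
      0 ≤ ∑ i, ∑ j, c i * c j * D.currentCorrelation Z.μ (τ j - τ i) :=
    fun n c τ => Z.sum_mul_currentCorrelation_nonneg hR Finset.univ c τ
  obtain ⟨σ, hfin, hcos, hgnn, hwin⟩ :=
    stub_spectralWindow (D.currentCorrelation Z.μ) hCcont heven hpd δ hδ g hg hconv
  exact ⟨Z.μ, D, hG, Z.preservesMeasure, fun t => Z.hasAbsConvergentCorrelation hmean t,
    σ, hfin, hcos, δ, g, hδ, hg, hgnn, hg0, hwin⟩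

/-- **The crux from stub D with its registered signature** (`A → B → towerFloor → LAP`): the three hypotheses
of D are theorems of the tree (A `stub_pairThreshold`, B `freeLevelShift_threshold`, towerFloor
`stub_oddTowerFloor stub_oddParityFloor`), so the checked skeleton of line `swap-odd-threshold-rigidity` reduces
to D inside the tree. [folklore] -/
theorem mourreDissolution_of_stub_oddThresholdLAP :
    (
    (∀ ω₂ : ℝ, 0 < ω₂ → ∀ k₁ k₂ k₃ : ℝ,
        resonanceFn ω₂ k₁ k₂ k₃ = 0 →
        groupVelocity ω₂ k₁ = groupVelocity ω₂ k₂ →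
        groupVelocity ω₂ k₂ = groupVelocity ω₂ k₃ →
        groupVelocity ω₂ k₃ = groupVelocity ω₂ (k₁ + k₂ - k₃) →
        (∃ n : ℤ, k₃ = k₁ + 2 * Real.pi * n) ∨ (∃ n : ℤ, k₃ = k₂ + 2 * Real.pi * n)) →
    (∀ ω₂ a b : ℝ, 0 < ω₂ → ∀ f : ℝ → ℝ, Function.Periodic f (2 * Real.pi) → ContDiff ℝ 3 f →
        ∃ δ : ℝ, 0 < δ ∧ ∃ ρ : ℝ → ℝ, ContinuousOn ρ (Set.Ioo (-δ) δ) ∧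
          ENNReal.ofReal (ρ 0) = ENNReal.ofReal (4 * Real.pi / alsPrefactor) * boltzmannForm ω₂ a b f ∧
          TendstoLocallyUniformlyOn
            (fun (ν : ℝ) (E : ℝ) => ∫ k₁ in Set.Ioc (-Real.pi) Real.pi, ∫ k₃ in Set.Ioc (-Real.pi) Real.pi,
              ∫ k₂ in Set.Ioc (-Real.pi) Real.pi,
                vertex a b k₁ k₂ k₃ ^ 2 /
                    (dispersion ω₂ k₁ * dispersion ω₂ k₂ * dispersion ω₂ k₃ * dispersion ω₂ (k₁ + k₂ - k₃)) ^ 2 *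
                  (f k₁ + f k₂ - f k₃ - f (k₁ + k₂ - k₃)) ^ 2 *
                  (ν / ((resonanceFn ω₂ k₁ k₂ k₃ - E) ^ 2 + ν ^ 2)))
            ρ (𝓝[>] (0 : ℝ)) (Set.Ioo (-δ) δ)) →
    (∀ ω₂ a b : ℝ, 0 < ω₂ → HasOddSectorGap ω₂ a b → ∃ g : ℝ, 0 < g ∧
        ∀ (m : ℕ) (F : (Fin (m + 1) → ℝ) → ℝ),
          (∀ k, F (-k) = -F k) →
          (∀ (k : Fin (m + 1) → ℝ) (i : Fin (m + 1)), F (Function.update k i (k i + 2 * Real.pi)) = F k) →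
          Measurable F →
          (∫⁻ k in Set.pi Set.univ (fun _ : Fin (m + 1) => Set.Ioc (-Real.pi) Real.pi),
              ENNReal.ofReal (F k ^ 2)) < ⊤ →
          ENNReal.ofReal g *
              (∫⁻ k in Set.pi Set.univ (fun _ : Fin (m + 1) => Set.Ioc (-Real.pi) Real.pi),
                ENNReal.ofReal (F k ^ 2)) ≤
            ∑ i : Fin (m + 1),
              ∫⁻ k in Set.pi Set.univ (fun _ : Fin (m + 1) => Set.Ioc (-Real.pi) Real.pi),
                boltzmannForm ω₂ a b (fun s => F (Function.update k i s))) →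
  ∀ ω₂ lam β γ : ℝ, 0 < ω₂ → 0 < lam → 0 < β → 0 < γ → HasOddSectorGap ω₂ lam β →
    ∃ T₀ : ℝ, 0 < T₀ ∧ ∀ T : ℝ, 0 < T → T < T₀ →
      ∀ (D : InfiniteChainDynamics (pinnedChain ω₂ lam β γ))
        (Z : ZeroWavenumberData (pinnedChain ω₂ lam β γ) D),
        (pinnedChain ω₂ lam β γ).IsChainGibbsMeasure T Z.μ →
        (pinnedChain ω₂ lam β γ).HasSuperstabilityEstimate Z.μ →
        Z.HasMomentumReversal →
        Z.toFluctuationDynamics.IsStronglyContinuous →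
        MeasurePreserving (fun (σ : ChainConfig) (i : ℤ) => σ (-i)) Z.μ Z.μ →
        Set.MapsTo (fun (σ : ChainConfig) (i : ℤ) => σ (-i)) D.carrier D.carrier →
        (∀ a ∈ Z.localObs, (a ∘ fun (σ : ChainConfig) (i : ℤ) => σ (-i)) ∈ Z.localObs) →
        (∀ t : ℝ, (fun (σ : ChainConfig) (i : ℤ) => σ (-i)) ∘ D.flow t =ᵐ[Z.μ]
          D.flow t ∘ fun (σ : ChainConfig) (i : ℤ) => σ (-i)) →
        ∃ δ : ℝ, 0 < δ ∧ ∃ g : ℝ → ℝ, ContinuousOn g (Set.Ioo (-δ) δ) ∧ 0 < g 0 ∧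
          TendstoLocallyUniformlyOn
            (fun (ν : ℝ) (ω : ℝ) => ∫ t in Set.Ioi (0 : ℝ),
              Real.exp (-(ν * t)) * (Real.cos (ω * t) * D.currentCorrelation Z.μ t))
            (fun ω => Real.pi * g ω) (𝓝[>] (0 : ℝ)) (Set.Ioo (-δ) δ)) →
    Summit.AtomisticToContinuum.FouriersLaw.Theses.EmbeddedDrudeMourre.MourreDissolution :=
  fun hD => mourreDissolution_of_oddThresholdLAP
    (hD stub_pairThreshold freeLevelShift_threshold (stub_oddTowerFloor stub_oddParityFloor))

end Summit.AtomisticToContinuum.FouriersLaw.Theorems.MourreDissolution
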